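import Literature.NumberTheory.LFunctions.RosserSchoenfeldMertensChainCheck
import HarnessLib

/-!
# Rosser–Schoenfeld 1962, (3.21) on `1 < x < 4 599 989` by kernel computation: certified run,
# chunk 16 of 17

Literature/NumberTheory/LFunctions. Pure proof file (a kernel computation; nothing is asserted, no
definition). `run16` evaluates `MertensChain.runD 20000` — at most `20000` steps of the (3.21)-chain
of `RosserSchoenfeldMertensChainCheck.lean` along the prime table `ChainTable.table`, each
certifying the primality of the next entry `p'`, extending the enclosure of `log p'`, performing the
comparison `log p' + E − 1/(2 log p') ≤ Σ_{q ≤ p} (log q)/q` behind Rosser–Schoenfeld's (3.21) on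
the interval `[p, p')` just closed, and accumulating the lower bounds of `Σ_{q ≤ p'} (log q)/q` and
`Σ_{q ≤ p'} (log q)/(q(q−1))` — on the state reached after `300000` steps (the prime `4256249`)
and records the resulting state (the prime `4562707`). The meaning of these states is supplied by
`MertensChain.runD_sound` (`RosserSchoenfeldMertensChainSound.lean`: the invariant `Inv` is
preserved); the 17 chunks are assembled in `RosserSchoenfeldEq321Tabulated.lean`. The expected
states were obtained by evaluating the same function (interpreted). `decide +kernel`, standard
axioms only (`maxHeartbeats 0` lifts the deterministic time-out for this one declaration).

## References
* J. B. Rosser, L. Schoenfeld, Illinois J. Math. 6 (1962), 64–94, Thm. 6 (3.21) and pp. 76, 87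
  (the tabulated ranges of its proof). [RosserSchoenfeld1962]
-/

namespace Literature.NumberTheory.LFunctions.MertensChainRun

open MertensChain

set_option maxHeartbeats 0 in
/-- **Chunk 16 of the certified (3.21)-run** (steps `300000` to `320000`, primes `4256249` to
`4562707`). [cite: RosserSchoenfeld1962, Thm. 6 (3.21)] -/
theorem run16 :
    runD 20000
      ⟨4256249, 18452921384146459245610650, 18452921384146934858885868,
        16842559061655140801032344, 913181915127302400898818⟩ =
    some ⟨4562707, 18536975375161550214835482, 18536975375162025828568185,
        16926477892129454563681904, 913181934173029999325009⟩ := by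
  decide +kernel

end Literature.NumberTheory.LFunctions.MertensChainRun
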